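/-
Copyright (c) 2026 the pub-hodgecm-mathlib formalisation cell (harness21).  Prover seat hodgecm-mathlib-LH4-p08 (g10), req620 Track A «(D-RAM) FOUR-FRAME» squad, helper lane
on h413 = stmt-HodgeConjecture-24833 (count-neutral).  β sub-dealer LH4-p05 (g8) LEDGER #12∕#13: ROW R6 «SPECIAL κ-CLASSES», the EMPTY tail of the tower-3 κ-row (case (ii) of
R6-DERIVATION v2 §5).  2026-09-04.
-/
import Summits.HodgeConjecture.HodgeConjecture.Theorems.F0P3cDyRamLabelledOddGluedOffFootHighG3   -- ★ p861598 (F0P3a-p01 (g37), A′ tower 3): `depths_of_mem_stratum_G3_offFoot`; brings the G₃ vocabulary, `labelledOddCount`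
import Summits.HodgeConjecture.HodgeConjecture.Theorems.F0P3cDyRamElementDatumParity         -- ★ (F0P3a-p01): `depth_mod_two_eq_of_isElementDatum`
import HarnessLib

/-!
# Crux `H413`, line LH4 «(D-RAM) FOUR-FRAME» — (β) table, β-BOARD row R6 (tower 3): OFF THE GLUE FOOT AND ABOVE THE READ `n₃ < 2ρ + s + ℓ₀`, the glued stratum
# `![2ρ+s, 2ρ+s, 2ρ]` of tower 3 is EMPTY, so every cut table over it vanishes (the tail `s > s_g` of the κ-row)

Cell `hodgecm-mathlib` (D-0151), FLOOR 0, crux item H413 = `stmt-HodgeConjecture-24833`, route `HCCMUnconditional`; squad F0∕P3c∕LH4.  THEOREMS ONLY (no `def`, no instance, no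
notation, no `sorry`, default heartbeats); ★-only imports; lane `--supports stmt-HodgeConjecture-24833 --as helper` (count-neutral); pays NO row, states NO law.

WHY.  F0P3a-p01 (g37)'s tower-3 rest dispatcher `…RestDispatchG3.restValue_G3_of_rows` (cand 861faff0, 16:04Z) takes the κ-row binder
`hR6 : ∀ ρ s, 1 ≤ ρ → 1 ≤ s → 2 ∣ s → 2ρ + d%2 = n₂ → n₃ ≠ n₂ + s → ∀ i, ‹common shape at (2ρ+s,2ρ+s,2ρ)› = κ ρ s i` for EVERY even `s` on the κ-locus off the foot — below the read
(`2ρ + s + ℓ₀ < n₃`, the κ-classes proper: LH4-p11 (g9) ★ p861570∕p861621 inputs, this seat's R6-DERIVATION v2 06cc9a72∕0628fb8c) AND above it (`n₃ < 2ρ + s + ℓ₀`; equality is the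
excluded foot), where the closed form `κ₃ ρ s = (0, 0, ω(−1)ω(e_B)∕2·q^{2ρ+s∕2−1}·F(n₃ − ℓ₀ − 2ρ − s))` is `0` by ★ p861700 `bracket_eq_zero_above`.  THIS FILE is the lattice side of
that tail: ★ p861598 `depths_of_mem_stratum_G3_offFoot` (g37, A′ tower 3: off the foot every member has `2ρ + s ≤ n₃`, `2ρ ≤ n₂`, `2ρ ≤ n₁` — `T`-stability of the G₃ normal
form) and the depth parity `n₃ ≡ d (mod 2)` (★ `depth_mod_two_eq_of_isElementDatum`) turn `n₃ < 2ρ + s + ℓ₀` (`2 ∣ s`) into `n₃ < 2ρ + s`, so NO member exists: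
* §1 `stratum_G3_eq_empty_of_offFoot_of_read_lt` — the stratum is `∅`;
* §2 `finsum_stratum_G3_sep_eq_zero_of_offFoot_of_read_lt` — every `Σᶠ` over a cut of it is `0`; `finsum_stratum_G3_shell_labelledOdd_div_relIndex_eq_zero_of_offFoot_of_read_lt` — the
  β-BOARD common shape (any square-token level `ℓ₂`, any label `Λ`, any slot) is `0`.
No cell, read, token or κ-locus hypothesis is needed (the κ-locus only makes the statement the one `hR6` wants); it also covers the non-special keys on the locus (`n₂ = n₃ ≤ n₁` or
equilateral), where `s ≥ 2` already puts the stratum above the read.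
HONEST LABEL.  Count-neutral helper (an EMPTY cell, value `0`); the κ-row below the read, R6, hRest, (β-BAL), (β), T₊ remain OPEN; `HC_CM` is proved only modulo the 7 printed
citations (2 remaining named inputs: hLiu418 = `stmt-HodgeConjecture-24832`, h413 = `stmt-HodgeConjecture-24833`) until rung 0 closes.

## References
* [Kottwitz1986BaseChangeUnits] R. E. Kottwitz, *Base change for unit elements of Hecke algebras*, Compositio Math. 60 (1986), §1 pp. 240–241 (lattice counts by strata; stability).
* [Serre1980Trees] J.-P. Serre, *Trees*, Springer (1980), Ch. II §1.1 (lattices `g·𝒪^N`, Hermite normal forms).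
* [Rogawski1990] J. D. Rogawski, *Automorphic Representations of Unitary Groups in Three Variables*, Ann. of Math. Stud. 123 (1990), §4.9 Prop. 4.9.1 (a)(b) p. 55.
-/

set_option autoImplicit false

noncomputable section

namespace Summit.HodgeConjecture.HodgeConjecture.Cruxes.H413.F0P3cDyRamLabelledOddKappaLocusAboveReadG3

open Literature.NumberTheory.Automorphic Literature.NumberTheory.Automorphic.HermitianLattice
open Literature.NumberTheory.Automorphic.UnitaryLatticeTree Literature.NumberTheory.Automorphic.UnitaryThreeFourFrame
open Literature.NumberTheory.LocalFields Literature.NumberTheory.LocalFields.WildQuadraticDatum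
open Summit.HodgeConjecture.HodgeConjecture.Cruxes.H413.F0P3cDyRamFourFramePieces
open Summit.HodgeConjecture.HodgeConjecture.Cruxes.H413.F0P3cDyRamFourFrameCensusDefs
open Summit.HodgeConjecture.HodgeConjecture.Cruxes.H413.F0P3cDyRamDiagonalTorusDefs
open Summit.HodgeConjecture.HodgeConjecture.Cruxes.H413.F0P3cDyRamDiagonalStrataDefs
open Summit.HodgeConjecture.HodgeConjecture.Cruxes.H413.F0P3cDyRamLabelledOddCountDefs
open Summit.HodgeConjecture.HodgeConjecture.Cruxes.H413.F0P3cDyRamLabelledOddGluedOffFootHighG3 (depths_of_mem_stratum_G3_offFoot)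
open Summit.HodgeConjecture.HodgeConjecture.Cruxes.H413.F0P3cDyRamElementDatumParity (depth_mod_two_eq_of_isElementDatum)
open scoped Valued WithZero Matrix MatrixGroups

variable {K : Type} [Field K] [Valued K ℤᵐ⁰] {σ : K →+* K} {ϖ : K} {d t : ℕ} {α β : K} {N₀ n₁ n₂ n₃ : ℕ}

/-! ## §1  Off the foot and above the read, the glued stratum of tower 3 is empty -/

/-- **ABOVE THE READ (`n₃ < 2ρ + s + ℓ₀`, `2 ∣ s`) AND OFF THE GLUE FOOT, THE STRATUM `(2ρ+s, 2ρ+s, 2ρ)` IS EMPTY**: a member would have `2ρ + s ≤ n₃` (★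
`depths_of_mem_stratum_G3_offFoot`), while `n₃ ≡ d (mod 2)` (★ `depth_mod_two_eq_of_isElementDatum`, `d ≤ N₀`) and `2 ∣ s` make `n₃ < 2ρ + s + ℓ₀` the same as `n₃ < 2ρ + s`.
[cite: Kottwitz1986BaseChangeUnits, §1 pp. 240–241] [cite: Serre1980Trees, Ch. II §1.1] -/
theorem stratum_G3_eq_empty_of_offFoot_of_read_lt (hD : IsRamifiedQuadraticDatum σ ϖ d t) (hE : IsElementDatum σ ϖ N₀ α β n₁ n₂ n₃) (hdN₀ : d ≤ N₀)
    (T : GL (Fin 3) K) (hT : (T : Matrix (Fin 3) (Fin 3) K) = Matrix.diagonal ![α, β, 1]) {ρ s : ℕ} (hρ : 1 ≤ ρ) (hs : 1 ≤ s) (h2s : 2 ∣ s)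
    (hfoot : n₃ ≠ n₂ + s) (hlt : n₃ < 2 * ρ + s + d % 2) : stratum σ ϖ T ![2 * ρ + s, 2 * ρ + s, 2 * ρ] = ∅ := by
  obtain ⟨-, -, hp3⟩ := depth_mod_two_eq_of_isElementDatum hD hE hdN₀
  refine Set.eq_empty_iff_forall_notMem.2 fun M hM => ?_
  obtain ⟨h3, -, -⟩ := depths_of_mem_stratum_G3_offFoot hD hE T hT hρ hs hfoot hM
  omega

/-! ## §2  Hence every cut table over it vanishes -/

/-- **EVERY CUT TABLE OVER THE EMPTY STRATUM VANISHES** (any predicate, any summand). [cite: Kottwitz1986BaseChangeUnits, §1 pp. 240–241] -/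
theorem finsum_stratum_G3_sep_eq_zero_of_offFoot_of_read_lt (hD : IsRamifiedQuadraticDatum σ ϖ d t) (hE : IsElementDatum σ ϖ N₀ α β n₁ n₂ n₃) (hdN₀ : d ≤ N₀)
    (T : GL (Fin 3) K) (hT : (T : Matrix (Fin 3) (Fin 3) K) = Matrix.diagonal ![α, β, 1]) {ρ s : ℕ} (hρ : 1 ≤ ρ) (hs : 1 ≤ s) (h2s : 2 ∣ s)
    (hfoot : n₃ ≠ n₂ + s) (hlt : n₃ < 2 * ρ + s + d % 2) (Q : Submodule 𝒪[K] (Fin 3 → K) → Prop) (f : Submodule 𝒪[K] (Fin 3 → K) → ℚ) :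
    ∑ᶠ M ∈ {M : Submodule 𝒪[K] (Fin 3 → K) | M ∈ stratum σ ϖ T ![2 * ρ + s, 2 * ρ + s, 2 * ρ] ∧ Q M}, f M = 0 := by
  have hempty : {M : Submodule 𝒪[K] (Fin 3 → K) | M ∈ stratum σ ϖ T ![2 * ρ + s, 2 * ρ + s, 2 * ρ] ∧ Q M} = ∅ := by
    refine Set.eq_empty_iff_forall_notMem.2 fun M hM => ?_
    have h := hM.1
    rw [stratum_G3_eq_empty_of_offFoot_of_read_lt hD hE hdN₀ T hT hρ hs h2s hfoot hlt] at h
    exact h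
  rw [hempty, finsum_mem_empty]

/-- **THE β-BOARD COMMON SHAPE ABOVE THE READ IS `0`** (off the foot; any square-token level `ℓ₂`, any label, any slot) — the lattice side of the EMPTY tail `s > s_g` of the tower-3
κ-row `hR6`, matching the `0` of the closed form there (★ p861700 `bracket_eq_zero_above`). [cite: Kottwitz1986BaseChangeUnits, §1 pp. 240–241]
[cite: Rogawski1990, §4.9 Prop. 4.9.1 (a)(b) p. 55] -/
theorem finsum_stratum_G3_shell_labelledOdd_div_relIndex_eq_zero_of_offFoot_of_read_lt (hD : IsRamifiedQuadraticDatum σ ϖ d t)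
    (hE : IsElementDatum σ ϖ N₀ α β n₁ n₂ n₃) (hdN₀ : d ≤ N₀) (T : GL (Fin 3) K) (hT : (T : Matrix (Fin 3) (Fin 3) K) = Matrix.diagonal ![α, β, 1])
    (ρ s : ℕ) (hρ : 1 ≤ ρ) (hs : 1 ≤ s) (h2s : 2 ∣ s) (hfoot : n₃ ≠ n₂ + s) (hlt : n₃ < 2 * ρ + s + d % 2) (ℓ₂ : ℕ) (i : Fin 3)
    (Λ : Submodule 𝒪[K] (Fin 3 → K) → (Fin 3 → K) → Prop) :
    ∑ᶠ M ∈ {M : Submodule 𝒪[K] (Fin 3 → K) | M ∈ stratum σ ϖ T ![2 * ρ + s, 2 * ρ + s, 2 * ρ] ∧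
        (LatticeInLevel ϖ (d % 2) (Matrix.diagonal ![α - 1, β - 1, 0]) M ∧ ¬ LatticeInLevel ϖ (d % 2 + 1) (Matrix.diagonal ![α - 1, β - 1, 0]) M ∧
          LatticeInLevel ϖ ℓ₂ (Matrix.diagonal ![(α - 1) * (α - 1), (β - 1) * (β - 1), 0]) M)},
      (labelledOddCount σ ϖ 0 i Λ M : ℚ) / ((((unitStabilizer M).map (unitNormMap σ 3)).relIndex (fixedUnitTorus σ 3) : ℕ) : ℚ) = 0 :=
  finsum_stratum_G3_sep_eq_zero_of_offFoot_of_read_lt hD hE hdN₀ T hT hρ hs h2s hfoot hlt _ _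

end Summit.HodgeConjecture.HodgeConjecture.Cruxes.H413.F0P3cDyRamLabelledOddKappaLocusAboveReadG3

end
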